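import Summits.AtomisticToContinuum.HydrodynamicLimit.Theses.LindebergRandomFuture
import Summits.AtomisticToContinuum.HydrodynamicLimit.Theorems.LambertianContactSwapLambertianEulerOfHearts
import Summits.AtomisticToContinuum.HydrodynamicLimit.Theses.LambertianContactSwap
import Summits.AtomisticToContinuum.HydrodynamicLimit.Theorems.LambertianContactSwapLambertianEulerArchimedes
import Summits.AtomisticToContinuum.HydrodynamicLimit.Theorems.LambertianContactSwapLambertianEulerLambertLaw
import Summits.AtomisticToContinuum.HydrodynamicLimit.Theorems.LambertianContactSwapLambertianEulerPovzner
import Summits.AtomisticToContinuum.HydrodynamicLimit.Theorems.LambertianContactSwapLambertianEulerPairPovzner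
import Summits.AtomisticToContinuum.HydrodynamicLimit.Theorems.LambertianContactSwapLambertianEulerContactIsotropy
import Summits.AtomisticToContinuum.HydrodynamicLimit.Theorems.LambertianContactSwapLambertianEulerMomentLedgerChain
import Summits.AtomisticToContinuum.HydrodynamicLimit.Theorems.LambertianContactSwapLambertianEulerGibbsInvariance
import Summits.AtomisticToContinuum.HydrodynamicLimit.Theorems.LambertianContactSwapLambertianEulerEntropyToHydro
import Summits.AtomisticToContinuum.HydrodynamicLimit.Theorems.LambertianContactSwapLambertianEulerWindow
import Summits.AtomisticToContinuum.HydrodynamicLimit.Theorems.LambertianContactSwapLambertianEulerMarkov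
import Summits.AtomisticToContinuum.HydrodynamicLimit.Theorems.LambertianContactSwapLambertianEulerIterate
import Summits.AtomisticToContinuum.HydrodynamicLimit.Theorems.LambertianContactSwapLambertianEulerDock
import Summits.AtomisticToContinuum.HydrodynamicLimit.Theorems.LambertianContactSwapLambertianEulerKlLedger
import Summits.AtomisticToContinuum.HydrodynamicLimit.Theorems.LambertianContactSwapLambertianEulerLawSemigroup
import Summits.AtomisticToContinuum.HydrodynamicLimit.Theorems.LambertianContactSwapLambertianEulerDockRf
import Summits.AtomisticToContinuum.HydrodynamicLimit.Theorems.LambertianContactSwapLambertianEulerLambertDirMean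
import Summits.AtomisticToContinuum.HydrodynamicLimit.Theorems.LambertianContactSwapLambertianEulerPairMeanSq
import Summits.AtomisticToContinuum.HydrodynamicLimit.Theorems.LambertianContactSwapLambertianEulerPathwiseProduction
import Summits.AtomisticToContinuum.HydrodynamicLimit.Theorems.LambertianContactSwapLambertianEulerWindowLedger
import Summits.AtomisticToContinuum.HydrodynamicLimit.Theorems.LambertianContactSwapLambertianEulerCollisionCompensator
import Summits.AtomisticToContinuum.HydrodynamicLimit.Theorems.LambertianContactSwapLambertianEulerCompensatedJump
import Summits.AtomisticToContinuum.HydrodynamicLimit.Theorems.LambertianContactSwapLambertianEulerAprioriEntropyBound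
import Summits.AtomisticToContinuum.HydrodynamicLimit.Theorems.LambertianContactSwapLambertianEulerCollisionIntensity
import Summits.AtomisticToContinuum.HydrodynamicLimit.Theorems.LambertianContactSwapLambertianEulerTwoTimeLaw
import Summits.AtomisticToContinuum.HydrodynamicLimit.Theorems.LambertianContactSwapLambertianEulerCollisionBudget
import Summits.AtomisticToContinuum.HydrodynamicLimit.Theorems.LambertianContactSwapLambertianEulerExpectedWindowProductionTools
import Summits.AtomisticToContinuum.HydrodynamicLimit.Theorems.LambertianContactSwapLambertianEulerExpectedWindowProduction
import Summits.AtomisticToContinuum.HydrodynamicLimit.Theorems.LambertianContactSwapLambertianEulerProductionSplit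
import Summits.AtomisticToContinuum.HydrodynamicLimit.Theorems.TwoClocksClampedEntropyClockTimeZeroReference
import Summits.AtomisticToContinuum.HydrodynamicLimit.Theorems.TwoClocksClampedEntropyClockDiscreteEntropyGronwall
import Summits.AtomisticToContinuum.HydrodynamicLimit.Theorems.TwoClocksClampedEntropyClockKlDivLawAtLocalGibbsNeTop
import Literature.MathematicalPhysics.KineticTheory.LambertianRedrawNondegenerate
import Literature.MathematicalPhysics.KineticTheory.Hilbert6Wave0Proofs
import Literature.MathematicalPhysics.KineticTheory.HardSphereEulerLLN
import Literature.Barriers.AtomisticToContinuum.HighMomentumCutoff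
import Literature.Analysis.FluidPDE.HardSphereAlexander
import HarnessLib
import Literature.MathematicalPhysics.KineticTheory.HardSphereEulerProofs
import Literature.MathematicalPhysics.KineticTheory.TwoTemperatureEuler
import Mathlib.Analysis.SpecialFunctions.NonIntegrable

/-! TTRL-lite variant V4536 of stmt-AtomisticToContinuum-11854 -/

noncomputable section

open scoped BigOperators Topology ENNReal InnerProductSpace
open MeasureTheory ProbabilityTheory Filter Set InformationTheory
open Literature.MathematicalPhysics.KineticTheory
open Literature.Analysis.FluidPDE Literature.Analysis.FluidPDE.Alexander
open Summit.AtomisticToContinuum.HydrodynamicLimit.Theses.LambertianContactSwap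
open Summit.AtomisticToContinuum.HydrodynamicLimit.Theorems.ClampedCurrentsDockPathwise (gSum DgSum)

namespace Summit.AtomisticToContinuum.HydrodynamicLimit.Theorems

/-- `∫₀^{1/2} a⁻¹ da = ∞` as a lower Lebesgue integral. [folklore] -/
theorem lintegral_inv_Ioo_half_eq_top_var4536 :
    ∫⁻ a in Ioo (0:ℝ) (1/2), ENNReal.ofReal (a⁻¹) = ∞ := by
  by_contra hne
  have hlt : ∫⁻ a in Ioo (0:ℝ) (1/2), ENNReal.ofReal (a⁻¹) < ∞ := lt_top_iff_ne_top.2 hne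
  have hint : IntegrableOn (fun a : ℝ => a⁻¹) (Ioo 0 (1/2)) := by
    refine ⟨measurable_inv.aestronglyMeasurable, ?_⟩
    show ∫⁻ a in Ioo (0:ℝ) (1/2), ‖a⁻¹‖ₑ < ∞
    calc ∫⁻ a in Ioo (0:ℝ) (1/2), ‖a⁻¹‖ₑ = ∫⁻ a in Ioo (0:ℝ) (1/2), ENNReal.ofReal (a⁻¹) := by
          refine setLIntegral_congr_fun measurableSet_Ioo (fun a ha => ?_)
          exact Real.enorm_eq_ofReal (inv_nonneg.2 ha.1.le)
      _ < ∞ := hlt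
  have hii : IntervalIntegrable (fun a : ℝ => a⁻¹) volume 0 (1/2) :=
    (intervalIntegrable_iff_integrableOn_Ioo_of_le (by norm_num)).2 hint
  rw [intervalIntegrable_inv_iff] at hii
  rcases hii with h0 | h0
  · norm_num at h0
  · exact h0 Set.left_mem_uIcc

/-- `∫ ‖θ‖⁻¹ dθ = ∞` on the unit circle. [folklore] -/
theorem lintegral_inv_norm_unitAddCircle_eq_top_var4536 :
    ∫⁻ θ : UnitAddCircle, ENNReal.ofReal (‖θ‖⁻¹) = ∞ := by
  rw [← UnitAddCircle.lintegral_preimage (-(1/2) : ℝ) (fun θ : UnitAddCircle => ENNReal.ofReal (‖θ‖⁻¹))]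
  refine eq_top_iff.2 ?_
  calc (⊤ : ℝ≥0∞) = ∫⁻ a in Ioo (0:ℝ) (1/2), ENNReal.ofReal (a⁻¹) :=
        lintegral_inv_Ioo_half_eq_top_var4536.symm
    _ = ∫⁻ a in Ioo (0:ℝ) (1/2), ENNReal.ofReal (‖((a : ℝ) : UnitAddCircle)‖⁻¹) := by
        refine setLIntegral_congr_fun measurableSet_Ioo (fun a ha => ?_)
        have h1 : ‖((a : ℝ) : UnitAddCircle)‖ = |a| := by
          rw [AddCircle.norm_coe_eq_abs_iff (1:ℝ) one_ne_zero]
          rw [abs_of_pos ha.1, abs_one]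
          linarith [ha.2]
        rw [h1, abs_of_pos ha.1]
    _ ≤ ∫⁻ a in Ioc (-(1/2):ℝ) (-(1/2) + 1), ENNReal.ofReal (‖((a : ℝ) : UnitAddCircle)‖⁻¹) :=
        lintegral_mono_set (fun a ha => ⟨by linarith [ha.1], by linarith [ha.2]⟩)

/-- `∫ ‖y₀‖⁻¹ dy = ∞` on the unit `3`-torus (first coordinate circle). [folklore] -/
theorem lintegral_inv_norm_apply_T3_eq_top_var4536 :
    ∫⁻ y : T3, ENNReal.ofReal (‖y 0‖⁻¹) = ∞ := by
  have hm : Measurable fun θ : UnitAddCircle => ENNReal.ofReal (‖θ‖⁻¹) :=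
    measurable_norm.inv.ennreal_ofReal
  have h := (measurePreserving_eval (fun _ : Fin 3 => (volume : Measure UnitAddCircle)) 0).lintegral_comp hm
  rw [volume_pi]
  exact h.trans lintegral_inv_norm_unitAddCircle_eq_top_var4536

section Shear

/-- Haar measure on `𝕋³` is right invariant (local instance). [folklore] -/
local instance instT3RightInv_var4536 : (volume : Measure T3).IsAddRightInvariant := by
  rw [volume_pi]; infer_instance

/-- Haar measure on `(𝕋³)^N` is right invariant (local instance). [folklore] -/
local instance instPiT3RightInv_var4536 {N : ℕ} : (volume : Measure (Fin N → T3)).IsAddRightInvariant := by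
  rw [volume_pi]; exact Measure.pi.isAddRightInvariant _

/-- The non-overlap set is invariant under a common translation of all centres. [folklore] -/
theorem add_const_mem_posDomain_iff_var4536 (ε : ℝ) (n : ℕ) (y : Fin n → T3) (c : T3) :
    (fun i => y i + c) ∈ posDomain ε n ↔ y ∈ posDomain ε n := by
  simp only [posDomain, mem_setOf_eq, Torus.euclidDist_eq, add_sub_add_right_eq_sub]

/-- **Shear lemma.** For measurable `h ≥ 0`,
`∫ 𝟙_{no overlap}(x) h(x₀) dx = (∫ h) · vol{w | (0, w) does not overlap}` (translate by `-x₀`).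
[folklore] -/
theorem lintegral_indicator_posDomain_apply_zero_var4536 (ε : ℝ) (N : ℕ) {h : T3 → ℝ≥0∞}
    (hh : Measurable h) :
    ∫⁻ x : Fin (N + 1) → T3, (posDomain ε (N + 1)).indicator (fun x => h (x 0)) x =
      (∫⁻ y, h y) * volume {w : Fin N → T3 |
        (MeasurableEquiv.piFinSuccAbove (fun _ : Fin (N + 1) => T3) 0).symm (0, w) ∈ posDomain ε (N + 1)} := by
  set P := posDomain ε (N + 1) with hP
  set e := MeasurableEquiv.piFinSuccAbove (fun _ : Fin (N + 1) => T3) 0 with he_def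
  set S : Set (Fin N → T3) := {w | e.symm (0, w) ∈ P} with hS
  have hPm : MeasurableSet P := measurableSet_posDomain ε (N + 1)
  have hSm : MeasurableSet S :=
    hPm.preimage (e.symm.measurable.comp (measurable_const.prodMk measurable_id))
  have he : MeasurePreserving e volume volume := volume_preserving_piFinSuccAbove (fun _ => T3) 0
  have hesymm : ∀ p : T3 × (Fin N → T3), e.symm p = Fin.cons p.1 p.2 := fun p => by
    simp [he_def, MeasurableEquiv.piFinSuccAbove_symm_apply, Fin.insertNthEquiv, Fin.insertNth_zero']
  set s : T3 × (Fin N → T3) → T3 × (Fin N → T3) := fun p => (p.1, p.2 + fun _ => p.1) with hs_def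
  have hs : MeasurePreserving s (volume : Measure (T3 × (Fin N → T3))) volume := by
    rw [Measure.volume_eq_prod]
    refine (MeasurePreserving.id volume).skew_product (g := fun t w => w + fun _ => t) ?_ ?_
    · exact measurable_snd.add (measurable_pi_lambda _ fun _ => measurable_fst)
    · exact Eventually.of_forall fun t => map_add_right_eq_self volume _
  have hkey : ∀ t w, e.symm (s (t, w)) = fun i => e.symm (0, w) i + t := by
    intro t w
    rw [hesymm, hesymm]
    funext i
    refine Fin.cases ?_ (fun j => ?_) i
    · simp [hs_def]
    · simp [hs_def]
  have hzero : ∀ w, e.symm (0, w) 0 = 0 := fun w => by rw [hesymm]; simp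
  have hF : Measurable fun x : Fin (N + 1) → T3 => P.indicator (fun x => h (x 0)) x :=
    (hh.comp (measurable_pi_apply 0)).indicator hPm
  calc ∫⁻ x, P.indicator (fun x => h (x 0)) x
      = ∫⁻ p, P.indicator (fun x => h (x 0)) (e.symm p) := ((he.symm e).lintegral_comp hF).symm
    _ = ∫⁻ p, P.indicator (fun x => h (x 0)) (e.symm (s p)) :=
        (hs.lintegral_comp (hF.comp e.symm.measurable)).symm
    _ = ∫⁻ p : T3 × (Fin N → T3), h p.1 * S.indicator 1 p.2 := by
        refine lintegral_congr fun p => ?_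
        obtain ⟨t, w⟩ := p
        rw [hkey t w]
        by_cases hw : w ∈ S
        · have hm : (fun i => e.symm (0, w) i + t) ∈ P :=
            (add_const_mem_posDomain_iff_var4536 ε (N + 1) _ t).2 hw
          rw [indicator_of_mem hm, indicator_of_mem hw]
          simp [hzero]
        · have hm : (fun i => e.symm (0, w) i + t) ∉ P := fun hm =>
            hw ((add_const_mem_posDomain_iff_var4536 ε (N + 1) _ t).1 hm)
          rw [indicator_of_notMem hm, indicator_of_notMem hw]
          simp
    _ = (∫⁻ t, h t) * ∫⁻ w, S.indicator 1 w := by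
        rw [Measure.volume_eq_prod]
        exact lintegral_prod_mul hh.aemeasurable ((measurable_one.indicator hSm).aemeasurable)
    _ = (∫⁻ t, h t) * volume S := by rw [lintegral_indicator_one hSm]

/-- The shear lemma with `h = 1`: `vol{no overlap} = vol{w | (0, w) does not overlap}`.
[folklore] -/
theorem volume_posDomain_eq_var4536 (ε : ℝ) (N : ℕ) :
    volume (posDomain ε (N + 1)) = volume {w : Fin N → T3 |
        (MeasurableEquiv.piFinSuccAbove (fun _ : Fin (N + 1) => T3) 0).symm (0, w) ∈ posDomain ε (N + 1)} := by
  have h := lintegral_indicator_posDomain_apply_zero_var4536 ε N (h := fun _ => 1) measurable_const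
  simp only [lintegral_const, measure_univ, one_mul] at h
  rw [← h, lintegral_indicator (measurableSet_posDomain ε (N + 1)), setLIntegral_const, one_mul]

end Shear

/-- The non-overlap set of `N + 1` centres at `σ ≤ 1/2` has positive volume. [folklore] -/
theorem volume_posDomain_pos_var4536 {σ : ℝ} (hσ2 : σ ≤ 1 / 2) (N : ℕ) :
    0 < volume (posDomain (hsDiameter σ N) (N + 1)) :=
  lt_of_lt_of_le (volume_setOf_lt_euclidDist_pos hσ2 N)
    (measure_mono fun _ hx i j hij => (hx i j hij).le)

/-- **Non-integrability of the hard-sphere Gibbs weight for the activity `1 + ‖x₀‖⁻¹`**: the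
unnormalised local Gibbs weight has infinite Lebesgue integral. [folklore] -/
theorem lintegral_gibbsWeight_bad_eq_top_var4536 {σ : ℝ} (hσ2 : σ ≤ 1 / 2) (N : ℕ) :
    ∫⁻ z, ENNReal.ofReal ((hardSphereDomain (Torus.geometry (Fin 3)) (N + 1) (hsDiameter σ N)).indicator
        (tensorPow (N + 1) (localGibbsProfile (fun y : T3 => 1 + ‖y 0‖⁻¹) (fun _ => (0 : V3))
          (fun _ => (1 : ℝ)))) z) = ∞ := by
  set ε := hsDiameter σ N with hε
  set a₀ : T3 → ℝ := fun y => 1 + ‖y 0‖⁻¹ with ha₀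
  set u₀ : T3 → V3 := fun _ => 0 with hu₀
  set θ₀ : T3 → ℝ := fun _ => 1 with hθ₀
  have ha_meas : Measurable a₀ := measurable_const.add ((measurable_pi_apply 0).norm.inv)
  have ha1 : ∀ y, 1 ≤ a₀ y := fun y => le_add_of_nonneg_right (inv_nonneg.2 (norm_nonneg _))
  have ha0 : ∀ y, 0 ≤ a₀ y := fun y => zero_le_one.trans (ha1 y)
  set F : Config (N + 1) (Fin 3) T3 → ℝ :=
    (hardSphereDomain (Torus.geometry (Fin 3)) (N + 1) ε).indicator
      (tensorPow (N + 1) (localGibbsProfile a₀ u₀ θ₀)) with hF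
  set M : V3 → ℝ := fun w => localMaxwellian 1 1 0 w with hM
  have hMpos : ∀ w, 0 < M w := fun w => localMaxwellian_pos one_pos one_pos _ _
  have hMc : Continuous M := continuous_localMaxwellian 1 1 0
  -- Step 1: positions × velocities
  have hpt : ∀ (x : Fin (N + 1) → T3) (v : Fin (N + 1) → V3),
      ENNReal.ofReal (F (zipConfig (x, v))) =
        ENNReal.ofReal (posWeight a₀ ε (N + 1) x) * ENNReal.ofReal (∏ i, M (v i)) := by
    intro x v
    rw [hF, indicator_tensorPow_zipConfig, ENNReal.ofReal_mul (posWeight_nonneg ha0 ε x)]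
  have hpw_meas : Measurable fun x : Fin (N + 1) → T3 => ENNReal.ofReal (posWeight a₀ ε (N + 1) x) :=
    ((Finset.measurable_prod _ fun i _ => ha_meas.comp (measurable_pi_apply i)).indicator
      (measurableSet_posDomain ε (N + 1))).ennreal_ofReal
  have hMprod_meas : Measurable fun v : Fin (N + 1) → V3 => ENNReal.ofReal (∏ i, M (v i)) :=
    (Finset.measurable_prod _ fun i _ => hMc.measurable.comp (measurable_pi_apply i)).ennreal_ofReal
  have hsplit : ∫⁻ z, ENNReal.ofReal (F z) =
      (∫⁻ x, ENNReal.ofReal (posWeight a₀ ε (N + 1) x)) *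
        ∫⁻ v : Fin (N + 1) → V3, ENNReal.ofReal (∏ i, M (v i)) := by
    calc ∫⁻ z, ENNReal.ofReal (F z)
        = ∫⁻ p, ENNReal.ofReal (F (zipConfig p)) ∂((volume : Measure (Fin (N + 1) → T3)).prod volume) := by
          rw [← measurePreserving_zipConfig.lintegral_comp_emb
            (MeasurableEquiv.arrowProdEquivProdArrow T3 V3 (Fin (N + 1))).symm.measurableEmbedding]
      _ = ∫⁻ p : (Fin (N + 1) → T3) × (Fin (N + 1) → V3),
            ENNReal.ofReal (posWeight a₀ ε (N + 1) p.1) * ENNReal.ofReal (∏ i, M (p.2 i))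
            ∂((volume : Measure (Fin (N + 1) → T3)).prod volume) := by
          refine lintegral_congr fun p => ?_
          exact hpt p.1 p.2
      _ = (∫⁻ x, ENNReal.ofReal (posWeight a₀ ε (N + 1) x)) *
            ∫⁻ v : Fin (N + 1) → V3, ENNReal.ofReal (∏ i, M (v i)) :=
          lintegral_prod_mul (μ := (volume : Measure (Fin (N + 1) → T3)))
            (ν := (volume : Measure (Fin (N + 1) → V3)))
            (f := fun x => ENNReal.ofReal (posWeight a₀ ε (N + 1) x))
            (g := fun v => ENNReal.ofReal (∏ i, M (v i))) hpw_meas.aemeasurable hMprod_meas.aemeasurable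
  -- Step 2: the velocity factor is nonzero
  have hvel : (∫⁻ v : Fin (N + 1) → V3, ENNReal.ofReal (∏ i, M (v i))) ≠ 0 := by
    intro h0
    rw [lintegral_eq_zero_iff hMprod_meas] at h0
    have huniv : (volume : Measure (Fin (N + 1) → V3)) univ = 0 := by
      have : ∀ᵐ v ∂(volume : Measure (Fin (N + 1) → V3)), False := by
        filter_upwards [h0] with v hv
        have : 0 < ENNReal.ofReal (∏ i, M (v i)) :=
          ENNReal.ofReal_pos.2 (Finset.prod_pos fun i _ => hMpos (v i))
        simp only [Pi.zero_apply] at hv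
        exact this.ne' hv
      simp only [ae_iff, not_false_eq_true, setOf_true] at this
      exact this
    have hpos : 0 < (volume : Measure (Fin (N + 1) → V3)) univ := by
      rw [volume_pi]
      exact isOpen_univ.measure_pos _ univ_nonempty
    exact hpos.ne' huniv
  -- Step 3: the position factor is infinite
  have hlow : ∀ x : Fin (N + 1) → T3,
      (posDomain ε (N + 1)).indicator (fun x => ENNReal.ofReal (‖x 0 0‖⁻¹)) x ≤
        ENNReal.ofReal (posWeight a₀ ε (N + 1) x) := by
    intro x
    by_cases hx : x ∈ posDomain ε (N + 1)
    · rw [indicator_of_mem hx, posWeight, indicator_of_mem hx]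
      refine ENNReal.ofReal_le_ofReal ?_
      calc ‖x 0 0‖⁻¹ ≤ a₀ (x 0) := le_add_of_nonneg_left zero_le_one
        _ = ∏ i : Fin (N + 1), (if i = 0 then a₀ (x 0) else 1) := by
            rw [Finset.prod_ite_eq']; simp
        _ ≤ ∏ i : Fin (N + 1), a₀ (x i) := by
            refine Finset.prod_le_prod (fun i _ => ?_) (fun i _ => ?_)
            · split_ifs
              · exact ha0 _
              · exact zero_le_one
            · split_ifs with hi
              · rw [hi]
              · exact ha1 _
    · rw [indicator_of_notMem hx]
      exact bot_le
  have hposS : 0 < volume {w : Fin N → T3 |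
      (MeasurableEquiv.piFinSuccAbove (fun _ : Fin (N + 1) => T3) 0).symm (0, w) ∈ posDomain ε (N + 1)} := by
    rw [← volume_posDomain_eq_var4536]
    exact volume_posDomain_pos_var4536 hσ2 N
  have hposfac : (∫⁻ x, ENNReal.ofReal (posWeight a₀ ε (N + 1) x)) = ∞ := by
    refine eq_top_iff.2 ?_
    calc (⊤ : ℝ≥0∞) = (∫⁻ y : T3, ENNReal.ofReal (‖y 0‖⁻¹)) * volume {w : Fin N → T3 |
          (MeasurableEquiv.piFinSuccAbove (fun _ : Fin (N + 1) => T3) 0).symm (0, w) ∈ posDomain ε (N + 1)} := by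
          rw [lintegral_inv_norm_apply_T3_eq_top_var4536, ENNReal.top_mul hposS.ne']
      _ = ∫⁻ x : Fin (N + 1) → T3, (posDomain ε (N + 1)).indicator (fun x => ENNReal.ofReal (‖x 0 0‖⁻¹)) x :=
          (lintegral_indicator_posDomain_apply_zero_var4536 ε N
            (h := fun y : T3 => ENNReal.ofReal (‖y 0‖⁻¹)) ((measurable_pi_apply 0).norm.inv.ennreal_ofReal)).symm
      _ ≤ ∫⁻ x, ENNReal.ofReal (posWeight a₀ ε (N + 1) x) := lintegral_mono hlow
  rw [hsplit, hposfac, ENNReal.top_mul hvel]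

/-- The canonical partition function of the bad activity vanishes (Bochner junk value of a
non-integrable weight). [folklore] -/
theorem canonicalPartition_bad_eq_zero_var4536 {σ : ℝ} (hσ2 : σ ≤ 1 / 2) (N : ℕ) :
    canonicalPartition (Torus.geometry (Fin 3)) (hsDiameter σ N) (N + 1)
      (localGibbsProfile (fun y : T3 => 1 + ‖y 0‖⁻¹) (fun _ => (0 : V3)) (fun _ => (1 : ℝ))) = 0 := by
  rw [canonicalPartition]
  refine integral_undef fun hI => ?_
  have hfin := hI.hasFiniteIntegral
  rw [HasFiniteIntegral] at hfin
  have ha0 : ∀ y : T3, 0 ≤ 1 + ‖y 0‖⁻¹ := fun y => by positivity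
  have hF0 : ∀ z, 0 ≤ (hardSphereDomain (Torus.geometry (Fin 3)) (N + 1) (hsDiameter σ N)).indicator
      (tensorPow (N + 1) (localGibbsProfile (fun y : T3 => 1 + ‖y 0‖⁻¹) (fun _ => (0 : V3))
        (fun _ => (1 : ℝ)))) z := fun z =>
    Set.indicator_nonneg (fun w _ =>
      tensorPow_nonneg (localGibbsProfile_nonneg ha0 fun _ => zero_le_one) (N + 1) w) z
  have heq : ∫⁻ z, ‖(hardSphereDomain (Torus.geometry (Fin 3)) (N + 1) (hsDiameter σ N)).indicator
      (tensorPow (N + 1) (localGibbsProfile (fun y : T3 => 1 + ‖y 0‖⁻¹) (fun _ => (0 : V3))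
        (fun _ => (1 : ℝ)))) z‖ₑ = ∞ := by
    rw [← lintegral_gibbsWeight_bad_eq_top_var4536 hσ2 N]
    refine lintegral_congr fun z => ?_
    exact Real.enorm_eq_ofReal (hF0 z)
  rw [heq] at hfin
  exact lt_irrefl _ hfin

/-- The local Gibbs law of the bad activity is the zero measure. [folklore] -/
theorem localGibbsLaw_bad_eq_zero_var4536 {σ : ℝ} (hσ2 : σ ≤ 1 / 2) (N : ℕ)
    (Φ : HardSphereFlow (Torus.geometry (Fin 3)) (hsDiameter σ N) (N + 1)) :
    localGibbsLaw σ (fun y : T3 => 1 + ‖y 0‖⁻¹) (fun _ => (0 : V3)) (fun _ => (1 : ℝ)) N Φ = 0 := by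
  rw [localGibbsLaw_eq, localGibbsMeasure]
  have h : (fun z => ENNReal.ofReal (canonicalDensity (Torus.geometry (Fin 3)) (hsDiameter σ N) (N + 1)
      (localGibbsProfile (fun y : T3 => 1 + ‖y 0‖⁻¹) (fun _ => (0 : V3)) (fun _ => (1 : ℝ))) z)) =
      fun _ => 0 := by
    funext z
    rw [canonicalDensity, canonicalPartition_bad_eq_zero_var4536 hσ2 N, inv_zero, zero_mul,
      ENNReal.ofReal_zero]
  rw [h]
  exact withDensity_zero

/-- **TTRL-lite variant V4536 of `stub_diluteSelfConsistency` is FALSE.** Dropping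
`Continuous a₀` admits the positive but not locally integrable activity `a₀(x) = 1 + ‖x₀‖⁻¹`, whose
local Gibbs laws are the zero measure (the canonical partition function is the Bochner junk value
`0`); then the `t = 0` field hypothesis holds for every Euler solution, in particular for the
constant state `ρ ≡ σ⁻³` with `ρσ³ = 1 ≥ η := 1`. Repaired statement: keep `Continuous a₀`
(or any hypothesis making the local Gibbs laws probability measures). [folklore] -/
theorem stub_diluteSelfConsistency_var4536_false : ¬ (∀ η : ℝ, 0 < η → ∀ (a₀ θ₀ : T3 → ℝ) (u₀ : T3 → V3), Continuous θ₀ → Continuous u₀ → (∀ x, 0 < a₀ x) → (∀ x, 0 < θ₀ x) → ∃ σ₀ : ℝ, 0 < σ₀ ∧ ∀ σ : ℝ, 0 < σ → σ < σ₀ → ∀ (T : ℝ) (ρ θ : ℝ → T3 → ℝ) (u : ℝ → T3 → V3), IsHardSphereEulerSolution σ T ρ u θ → ∀ Φ : (N : ℕ) → HardSphereFlow (Torus.geometry (Fin 3)) (hsDiameter σ N) (N + 1), TendstoHydroFieldsAt (fun N => localGibbsLaw σ a₀ u₀ θ₀ N (Φ N)) Φ ρ u θ 0 → ∀ t ∈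 Set.Ico 0 T, ∀ x, ρ t x * σ ^ 3 < η) := by
  intro h
  have hapos : ∀ y : T3, 0 < 1 + ‖y 0‖⁻¹ := fun y => by positivity
  obtain ⟨σ₀, hσ₀, hσ⟩ := h 1 one_pos (fun y : T3 => 1 + ‖y 0‖⁻¹) (fun _ => (1 : ℝ)) (fun _ => (0 : V3))
    continuous_const continuous_const hapos (fun _ => one_pos)
  set σ : ℝ := min (σ₀ / 2) (1 / 4) with hσdef
  have hσpos : 0 < σ := lt_min (by linarith) (by norm_num)
  have hσlt : σ < σ₀ := (min_le_left _ _).trans_lt (by linarith)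
  have hσ4 : σ ≤ 1 / 4 := min_le_right _ _
  have hσ2 : σ ≤ 1 / 2 := hσ4.trans (by norm_num)
  have hΦ : ∀ N, Nonempty (HardSphereFlow (Torus.geometry (Fin 3)) (hsDiameter σ N) (N + 1)) := fun N =>
    HardSphereFlow.nonempty_torus_holds (hsDiameter_pos hσpos N)
      ((hsDiameter_le hσpos.le N).trans_lt (by linarith)) (N + 1)
  let Φ : (N : ℕ) → HardSphereFlow (Torus.geometry (Fin 3)) (hsDiameter σ N) (N + 1) := fun N => (hΦ N).some
  have hσ3 : 0 < σ ^ 3 := by positivity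
  have hE : IsHardSphereEulerSolution σ 1 (fun _ _ => (σ ^ 3)⁻¹) (fun _ _ => (0 : V3)) (fun _ _ => (1 : ℝ)) :=
    (isTwoTemperatureEulerSolution_const σ 0 (fun _ _ _ => 0) 1 (inv_pos.2 hσ3) one_pos 0).isHardSphereEulerSolution_of_kappa_eq_zero
  have hT : TendstoHydroFieldsAt (fun N => localGibbsLaw σ (fun y : T3 => 1 + ‖y 0‖⁻¹) (fun _ => (0 : V3))
      (fun _ => (1 : ℝ)) N (Φ N)) Φ (fun _ _ => (σ ^ 3)⁻¹) (fun _ _ => (0 : V3)) (fun _ _ => (1 : ℝ)) 0 := by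
    intro χ _ δ _
    simp only [localGibbsLaw_bad_eq_zero_var4536 hσ2, Measure.coe_zero, Pi.zero_apply]
    exact ⟨tendsto_const_nhds, tendsto_const_nhds, tendsto_const_nhds⟩
  have hlt := hσ σ hσpos hσlt 1 _ _ _ hE Φ hT 0 ⟨le_rfl, one_pos⟩ 0
  rw [inv_mul_cancel₀ hσ3.ne'] at hlt
  exact lt_irrefl _ hlt

end Summit.AtomisticToContinuum.HydrodynamicLimit.Theorems

end
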